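import Summits.HubbardSuperconductivity.HubbardSuperconductivity.Theses.ChiralWindow
import Summits.HubbardSuperconductivity.HubbardSuperconductivity.Theses.KacWindowPenalty
import Summits.HubbardSuperconductivity.HubbardSuperconductivity.Theorems.WeakCouplingBCSWcbcsSsbToTorusLROReduction
import Summits.HubbardSuperconductivity.HubbardSuperconductivity.Theorems.ChiralWindowCwSsbToEvenTorusLROSlopeGlue
import HarnessLib

/-!
# Crux `CwSsbToEvenTorusLRO` (stmt-HubbardSuperconductivity-10439, route `ChiralWindow`) — the RESIDUE MAP:
# the crux BY NAME from each of the four {thermodynamic} × {infrared} residues the three sibling crux chains isolated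

The crux is `Iff.rfl`-identical to `WeakCouplingBCS.WcbcsSsbToTorusLRO` (stmt-2009; standing disprover's `cw_iff_wcbcs`).
Three line leads on the `Iff`-related cruxes stmt-10439 (line `griffiths-block-slope`), stmt-2009 (line
`off-zero-mode-moment-closure` ⊕ `neutral-curvature-face-purity`) and stmt-1315 converged on the same dissection
(landed `Negative.FacePurityDissection`): modulo the pointwise infrared LEAK at `(U, δ)`, the crux's consequent IS
every-ground-state block coherence at all scales (derivative face purity), which is NECESSARY for it
(`deriv_of_hasDWavePairFieldLROAt`). Every checked line therefore ends in one THERMODYNAMIC residue supplying face purity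
and one INFRARED residue supplying the leak:

* thermodynamic: S2' = GRC `stub_sourceFreeBlockSlopeFloor` of stmt-10439 (source-free grand-canonical block-slope floor
  `E₀(K_μ + κW_R) − E₀(K_μ) ≥ κ a L²`, `∀R ∃κ(R)`), or (N) `stub_neutralCurvature` of stmt-2009 (h-uniform floor
  `−C_R κ² L²` on the Kac-block second difference of the SOURCED torus energy);
* infrared: item stmt-1089 `KacWindowPenalty.WindowInfraredBound` BY NAME (or its weak-coupling pointwise form S7
  `stub_infraredLeak` of stmt-10439), or (T) ∧ (C) `stub_torusPairStiffness` ∧ `stub_chargingFloor` of stmt-2009.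

This file records, sorry-free and BY NAME, that EACH of the four combinations closes `ChiralWindow.CwSsbToEvenTorusLRO`
(the registered stub signatures appear verbatim as hypotheses — the shapes a planner files as items):
`cwSsbToEvenTorusLRO_of_slopeFloor_of_infraredLeak` (S2' ∧ S7 — the registered skeleton `Lines/griffiths_block_slope.lean`
v4.2 with its two open stubs as hypotheses), `cwSsbToEvenTorusLRO_of_slopeFloor_stiffness_charging` (S2' ∧ T ∧ C),
`cwSsbToEvenTorusLRO_of_neutralCurvature_of_windowInfraredBound` (N ∧ stmt-1089),
`cwSsbToEvenTorusLRO_of_stiffness_curvature_charging` (T ∧ N ∧ C, transported from the twin's landed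
`WcbcsSsbToTorusLRO.wcbcsSsbToTorusLRO_of_stiffness_curvature_charging` along `Iff.rfl`); the fourth corner
(S2' ∧ stmt-1089) is the landed `cwSsbToEvenTorusLRO_of_sourceFreeBlockSlopeFloor` (p100695). The canonical/grand-canonical
step (item stmt-9491) is discharged everywhere by the landed `stub_canonicalSupportingPotential`. No residue is claimed
here; each is open mathematical physics of constructive size (PROMOTE dossiers in `Cruxes/CwSsbToEvenTorusLRO/` and
`Cruxes/WcbcsSsbToTorusLRO/`). [folklore] bookkeeping over landed theorems; no definition is introduced.
-/

noncomputable section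

set_option linter.dupNamespace false

namespace Summit.HubbardSuperconductivity.HubbardSuperconductivity.Theorems.CwSsbToEvenTorusLRO

open Literature.MathematicalPhysics.QuantumLattice Literature.Probability.LatticeModels
  Literature.Barriers.HubbardSuperconductivity
open Summit.HubbardSuperconductivity.WcbcsSsbToTorusLRO.Negative
  (floor_of_deriv_of_leak hasDWavePairFieldLROAt_of_floor leak_of_windowInfraredBound)
open Summit.HubbardSuperconductivity.HubbardSuperconductivity.Theorems.WcbcsSsbToTorusLRO
  (wcbcsSsbToTorusLRO_of_stiffness_curvature_charging infraredLeak_of_stiffness_of_charging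
    derivFacePurity_of_neutralCurvature)
open Matrix Filter Set
open scoped ComplexOrder ComplexConjugate BigOperators

/-- **The crux from S2' and S7 (CONDITIONAL glue = the registered skeleton with its two open stubs as hypotheses).**
The guarded source-free block-slope floor S2' (`stub_sourceFreeBlockSlopeFloor`) and the guarded weak-coupling infrared
leak S7 (`stub_infraredLeak`, strictly weaker than item stmt-1089: only `U < U₀`, only under the crux hypotheses) imply
`ChiralWindow.CwSsbToEvenTorusLRO` BY NAME, with `U₀ :=` the smaller threshold. [folklore] -/
theorem cwSsbToEvenTorusLRO_of_slopeFloor_of_infraredLeak :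
    (∃ U₀ : ℝ, 0 < U₀ ∧ ∀ U ∈ Set.Ioo (0:ℝ) U₀, ∀ δ ∈ Set.Ioo (0:ℝ) (1 / 2), ∀ μ : ℝ, Filter.Tendsto (fun L : ℕ => ((hubbardTorusWith 2 (L + 1) 1 U μ).groundStateFunctional totalNumber).re / ((L + 1 : ℕ) : ℝ) ^ 2) Filter.atTop (nhds (1 - δ)) → HasDWaveOrder U μ → ∃ a : ℝ, 0 < a ∧ ∀ R : ℕ, 0 < R → ∃ κ : ℝ, 0 < κ ∧ ∀ᶠ k : ℕ in Filter.atTop, κ * a * ((2 * k + 1 + 1 : ℕ) : ℝ) ^ 2 ≤ (hubbardTorusWith 2 (2 * k + 1 + 1) 1 U μ + (κ : ℂ) • (((((R : ℝ) ^ 4)⁻¹ : ℝ) : ℂ) • ∑ a : Literature.Probability.LatticeModels.TorusSite 2 (2 * k + 1 + 1), (∑ u : Fin 2 → Fin R, localPair dWaveFormFactor (2 * k + 1 + 1) (a + fun i => ((u i : ℕ) : ZMod (2 * k + 1 + 1))))ᴴ * (∑ u : Fin 2 → Fin R, localPair dWaveFormFactor (2 * k + 1 + 1) (a + fun i => ((u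 i : ℕ) : ZMod (2 * k + 1 + 1)))))).groundEnergy - (hubbardTorusWith 2 (2 * k + 1 + 1) 1 U μ).groundEnergy) → (∃ U₀ : ℝ, 0 < U₀ ∧ ∀ U ∈ Set.Ioo (0:ℝ) U₀, ∀ δ ∈ Set.Ioo (0:ℝ) (1 / 2), ∀ μ : ℝ, Filter.Tendsto (fun L : ℕ => ((hubbardTorusWith 2 (L + 1) 1 U μ).groundStateFunctional totalNumber).re / ((L + 1 : ℕ) : ℝ) ^ 2) Filter.atTop (nhds (1 - δ)) → HasDWaveOrder U μ → ∀ b : ℝ, 0 < b → ∃ η : ℝ, 0 < η ∧ ∀ᶠ k : ℕ in Filter.atTop, ∀ ψ : Fock (Orb (FermionTorus 2 (2 * k + 1 + 1))), IsGroundStateInSector (hubbardTorus 2 (2 * k + 1 + 1) 1 U) (2 * ⌊(1 - δ) * ((2 * k + 1 + 1 : ℕ) : ℝ) ^ 2 / 2⌋₊) 0 ψ → star ψ ⬝ᵥ ψ = 1 → (∑ m ∈ (Finset.univ.filter fun m : Literature.Probability.LatticeModels.TorusSite 2 (2 * k + 1 + 1) => m ≠ 0 ∧ momentumNormSq (2 *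 k + 1 + 1) m < η ^ 2), pairStructureFactor dWaveFormFactor (2 * k + 1 + 1) ψ m) / ((2 * k + 1 + 1 : ℕ) : ℝ) ^ 2 ≤ b) → Summit.HubbardSuperconductivity.HubbardSuperconductivity.Theses.ChiralWindow.CwSsbToEvenTorusLRO := by
  intro hS hIR
  obtain ⟨U₁, hU₁, hS⟩ := hS
  obtain ⟨U₂, hU₂, hIR⟩ := hIR
  refine ⟨min U₁ U₂, lt_min hU₁ hU₂, fun U hU δ hδ μ hdm hord => ?_⟩
  have hU1 : U ∈ Set.Ioo (0:ℝ) U₁ := ⟨hU.1, lt_of_lt_of_le hU.2 (min_le_left _ _)⟩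
  have hU2 : U ∈ Set.Ioo (0:ℝ) U₂ := ⟨hU.1, lt_of_lt_of_le hU.2 (min_le_right _ _)⟩
  exact hasDWavePairFieldLROAt_of_slopeFloorAt hδ hdm (hS U hU1 δ hδ μ hdm hord) (hIR U hU2 δ hδ μ hdm hord)

/-- **The crux from S2', torus pair stiffness (T) and the charging floor (C) (CONDITIONAL glue).** The thermodynamic
residue of line `griffiths-block-slope` (stmt-10439) combined with the INFRARED residues of the twin's line
`off-zero-mode-moment-closure` (stmt-2009: registered `stub_torusPairStiffness`, `stub_chargingFloor`), through the twin's
landed `infraredLeak_of_stiffness_of_charging` (T ∧ C ⇒ pointwise leak) and `hasDWavePairFieldLROAt_of_slopeFloorAt`. [folklore] -/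
theorem cwSsbToEvenTorusLRO_of_slopeFloor_stiffness_charging :
    (∃ U₀ : ℝ, 0 < U₀ ∧ ∀ U ∈ Set.Ioo (0:ℝ) U₀, ∀ δ ∈ Set.Ioo (0:ℝ) (1 / 2), ∀ μ : ℝ, Filter.Tendsto (fun L : ℕ => ((hubbardTorusWith 2 (L + 1) 1 U μ).groundStateFunctional totalNumber).re / ((L + 1 : ℕ) : ℝ) ^ 2) Filter.atTop (nhds (1 - δ)) → HasDWaveOrder U μ → ∃ a : ℝ, 0 < a ∧ ∀ R : ℕ, 0 < R → ∃ κ : ℝ, 0 < κ ∧ ∀ᶠ k : ℕ in Filter.atTop, κ * a * ((2 * k + 1 + 1 : ℕ) : ℝ) ^ 2 ≤ (hubbardTorusWith 2 (2 * k + 1 + 1) 1 U μ + (κ : ℂ) • (((((R : ℝ) ^ 4)⁻¹ : ℝ) : ℂ) • ∑ a : Literature.Probability.LatticeModels.TorusSite 2 (2 * k + 1 + 1), (∑ u : Fin 2 → Fin R, localPair dWaveFormFactor (2 * k + 1 + 1) (a + fun i => ((u i : ℕ) : ZMod (2 * k + 1 + 1))))ᴴ * (∑ u : Fin 2 → Fin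 R, localPair dWaveFormFactor (2 * k + 1 + 1) (a + fun i => ((u i : ℕ) : ZMod (2 * k + 1 + 1)))))).groundEnergy - (hubbardTorusWith 2 (2 * k + 1 + 1) 1 U μ).groundEnergy) → (∃ U₀ : ℝ, 0 < U₀ ∧ ∀ U ∈ Set.Ioo (0:ℝ) U₀, ∀ δ ∈ Set.Ioo (0:ℝ) (1 / 2), ∀ μ : ℝ, Filter.Tendsto (fun L : ℕ => ((hubbardTorusWith 2 (L + 1) 1 U μ).groundStateFunctional totalNumber).re / ((L + 1 : ℕ) : ℝ) ^ 2) Filter.atTop (nhds (1 - δ)) → HasDWaveOrder U μ → ∃ C η : ℝ, 0 < η ∧ ∀ᶠ k : ℕ in Filter.atTop, ∀ ψ : Fock (Orb (FermionTorus 2 (2 * k + 1 + 1))), IsGroundStateInSector (hubbardTorus 2 (2 * k + 1 + 1) 1 U) (2 * ⌊(1 - δ) * ((2 * k + 1 + 1 : ℕ) : ℝ) ^ 2 / 2⌋₊) 0 ψ → star ψ ⬝ᵥ ψ = 1 → ∀ m : TorusSite 2 (2 * k + 1 + 1), m ≠ 0 → momentumNormSq (2 * k + 1 + 1) m < η ^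 2 → (∀ w : Fock (Orb (FermionTorus 2 (2 * k + 1 + 1))), w ∈ szSector (Λ := FermionTorus 2 (2 * k + 1 + 1)) (2 * ⌊(1 - δ) * ((2 * k + 1 + 1 : ℕ) : ℝ) ^ 2 / 2⌋₊ - 2) 0 → 2 * (star w ⬝ᵥ (pairFieldAt dWaveFormFactor (2 * k + 1 + 1) m *ᵥ ψ)).re - ((star w ⬝ᵥ (hubbardTorus 2 (2 * k + 1 + 1) 1 U *ᵥ w)).re - (hubbardTorus 2 (2 * k + 1 + 1) 1 U).minEnergyOn (szSector (2 * ⌊(1 - δ) * ((2 * k + 1 + 1 : ℕ) : ℝ) ^ 2 / 2⌋₊ - 2) 0) * (star w ⬝ᵥ w).re) ≤ C * ((2 * k + 1 + 1 : ℕ) : ℝ) ^ 2 / momentumNormSq (2 * k + 1 + 1) m) ∧ (∀ w : Fock (Orb (FermionTorus 2 (2 * k + 1 + 1))), w ∈ szSector (Λ := FermionTorus 2 (2 * k + 1 + 1)) (2 * ⌊(1 - δ) * ((2 * k + 1 + 1 : ℕ) : ℝ) ^ 2 / 2⌋₊ + 2) 0 → 2 * (star w ⬝ᵥ ((pairFieldAt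 dWaveFormFactor (2 * k + 1 + 1) m)ᴴ *ᵥ ψ)).re - ((star w ⬝ᵥ (hubbardTorus 2 (2 * k + 1 + 1) 1 U *ᵥ w)).re - (hubbardTorus 2 (2 * k + 1 + 1) 1 U).minEnergyOn (szSector (2 * ⌊(1 - δ) * ((2 * k + 1 + 1 : ℕ) : ℝ) ^ 2 / 2⌋₊ + 2) 0) * (star w ⬝ᵥ w).re) ≤ C * ((2 * k + 1 + 1 : ℕ) : ℝ) ^ 2 / momentumNormSq (2 * k + 1 + 1) m)) → (∃ U₀ : ℝ, 0 < U₀ ∧ ∀ U ∈ Set.Ioo (0:ℝ) U₀, ∀ δ ∈ Set.Ioo (0:ℝ) (1 / 2), ∀ μ : ℝ, Filter.Tendsto (fun L : ℕ => ((hubbardTorusWith 2 (L + 1) 1 U μ).groundStateFunctional totalNumber).re / ((L + 1 : ℕ) : ℝ) ^ 2) Filter.atTop (nhds (1 - δ)) → HasDWaveOrder U μ → ∀ ε : ℝ, 0 < ε → ∀ᶠ k : ℕ in Filter.atTop, -ε ≤ (1 + Real.log ((2 * k + 1 + 1 : ℕ) : ℝ)) * pairGap (hubbardTorus 2 (2 *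 k + 1 + 1) 1 U) (2 * ⌊(1 - δ) * ((2 * k + 1 + 1 : ℕ) : ℝ) ^ 2 / 2⌋₊)) → Summit.HubbardSuperconductivity.HubbardSuperconductivity.Theses.ChiralWindow.CwSsbToEvenTorusLRO := by
  intro hS hT hC
  obtain ⟨U₁, hU₁, hS⟩ := hS
  obtain ⟨U₂, hU₂, hT⟩ := hT
  obtain ⟨U₃, hU₃, hC⟩ := hC
  refine ⟨min U₁ (min U₂ U₃), lt_min hU₁ (lt_min hU₂ hU₃), fun U hU δ hδ μ hdm hord => ?_⟩
  have hU1 : U ∈ Set.Ioo (0:ℝ) U₁ := ⟨hU.1, lt_of_lt_of_le hU.2 (min_le_left _ _)⟩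
  have hU2 : U ∈ Set.Ioo (0:ℝ) U₂ := ⟨hU.1, lt_of_lt_of_le hU.2 ((min_le_right _ _).trans (min_le_left _ _))⟩
  have hU3 : U ∈ Set.Ioo (0:ℝ) U₃ := ⟨hU.1, lt_of_lt_of_le hU.2 ((min_le_right _ _).trans (min_le_right _ _))⟩
  exact hasDWavePairFieldLROAt_of_slopeFloorAt hδ hdm (hS U hU1 δ hδ μ hdm hord)
    (infraredLeak_of_stiffness_of_charging U δ hU.1 hδ (hT U hU2 δ hδ μ hdm hord) (hC U hU3 δ hδ μ hdm hord))

/-- **The crux from the neutral-curvature floor (N) and item stmt-1089 (CONDITIONAL glue).** The thermodynamic residue of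
the twin's line (stmt-2009: registered `stub_neutralCurvature`, the certificate of Transfer A / no block kink of THIS
crux's card `griffiths-block-slope`) with item stmt-1089 `KacWindowPenalty.WindowInfraredBound` BY NAME: the twin's landed
`derivFacePurity_of_neutralCurvature` (with item stmt-9491 discharged by the landed `stub_canonicalSupportingPotential`),
the pointwise leak `leak_of_windowInfraredBound`, the dissection `floor_of_deriv_of_leak` and the floor/matrix identity
`hasDWavePairFieldLROAt_of_floor`. [folklore] -/
theorem cwSsbToEvenTorusLRO_of_neutralCurvature_of_windowInfraredBound :
    (∃ U₀ : ℝ, 0 < U₀ ∧ ∀ U ∈ Set.Ioo (0:ℝ) U₀, ∀ δ ∈ Set.Ioo (0:ℝ) (1 / 2), ∀ μ : ℝ, Filter.Tendsto (fun L : ℕ => ((hubbardTorusWith 2 (L + 1) 1 U μ).groundStateFunctional totalNumber).re / ((L + 1 : ℕ) : ℝ) ^ 2) Filter.atTop (nhds (1 - δ)) → HasDWaveOrder U μ → ∀ R : ℕ, 0 < R → ∃ C : ℝ, 0 ≤ C ∧ ∃ κ₀ : ℝ, 0 < κ₀ ∧ ∃ h₀ : ℝ, 0 < h₀ ∧ ∀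 κ ∈ Set.Ioo (0:ℝ) κ₀, ∀ h ∈ Set.Ioo (0:ℝ) h₀, ∀ᶠ L : ℕ in Filter.atTop, -C * κ ^ 2 * ((L + 1 : ℕ) : ℝ) ^ 2 ≤ (dWaveSourceTorus (L + 1) U μ h + (κ : ℂ) • (((((R : ℝ) ^ 4)⁻¹ : ℝ) : ℂ) • ∑ a : Literature.Probability.LatticeModels.TorusSite 2 (L + 1), (∑ u : Fin 2 → Fin R, localPair dWaveFormFactor (L + 1) (a + fun i => ((u i : ℕ) : ZMod (L + 1))))ᴴ * (∑ u : Fin 2 → Fin R, localPair dWaveFormFactor (L + 1) (a + fun i => ((u i : ℕ) : ZMod (L + 1)))))).groundEnergy + (dWaveSourceTorus (L + 1) U μ h + ((-κ : ℝ) : ℂ) • (((((R : ℝ) ^ 4)⁻¹ : ℝ) : ℂ) • ∑ a : Literature.Probability.LatticeModels.TorusSite 2 (L + 1), (∑ u : Fin 2 → Fin R, localPair dWaveFormFactor (L + 1) (a + fun i => ((u i : ℕ) : ZMod (L + 1))))ᴴ * (∑ u : Fin 2 → Fin R, localPair dWaveFormFactor (L + 1) (a + fun i => ((u i : ℕ)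 : ZMod (L + 1)))))).groundEnergy - 2 * (dWaveSourceTorus (L + 1) U μ h).groundEnergy) → Summit.HubbardSuperconductivity.HubbardSuperconductivity.Theses.KacWindowPenalty.WindowInfraredBound → Summit.HubbardSuperconductivity.HubbardSuperconductivity.Theses.ChiralWindow.CwSsbToEvenTorusLRO := by
  intro hN hW
  obtain ⟨U₀, hU₀, hN⟩ := hN
  refine ⟨U₀, hU₀, fun U hU δ hδ μ hdm hord => ?_⟩
  have hP := derivFacePurity_of_neutralCurvature U δ μ hδ (hN U hU δ hδ μ hdm hord)
    (stub_canonicalSupportingPotential U δ ⟨hδ.1, by linarith [hδ.2]⟩) hdm hord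
  exact hasDWavePairFieldLROAt_of_floor (floor_of_deriv_of_leak hP (leak_of_windowInfraredBound hW hU.1 hδ))

/-- **The crux from (T), (N), (C) — transported from the twin.** `ChiralWindow.CwSsbToEvenTorusLRO` and
`WeakCouplingBCS.WcbcsSsbToTorusLRO` have definitionally equal bodies (`Iff.rfl`), so the twin's landed reduction
`wcbcsSsbToTorusLRO_of_stiffness_curvature_charging` closes THIS crux modulo the same three registered statements of
stmt-2009 (`stub_torusPairStiffness`, `stub_neutralCurvature`, `stub_chargingFloor`) and nothing else. [folklore] -/
theorem cwSsbToEvenTorusLRO_of_stiffness_curvature_charging :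
    (∃ U₀ : ℝ, 0 < U₀ ∧ ∀ U ∈ Set.Ioo (0:ℝ) U₀, ∀ δ ∈ Set.Ioo (0:ℝ) (1 / 2), ∀ μ : ℝ, Filter.Tendsto (fun L : ℕ => ((hubbardTorusWith 2 (L + 1) 1 U μ).groundStateFunctional totalNumber).re / ((L + 1 : ℕ) : ℝ) ^ 2) Filter.atTop (nhds (1 - δ)) → HasDWaveOrder U μ → ∃ C η : ℝ, 0 < η ∧ ∀ᶠ k : ℕ in Filter.atTop, ∀ ψ : Fock (Orb (FermionTorus 2 (2 * k + 1 + 1))), IsGroundStateInSector (hubbardTorus 2 (2 * k + 1 + 1) 1 U) (2 * ⌊(1 - δ) * ((2 * k + 1 + 1 : ℕ) : ℝ) ^ 2 / 2⌋₊) 0 ψ → star ψ ⬝ᵥ ψ = 1 → ∀ m : TorusSite 2 (2 * k + 1 + 1), m ≠ 0 → momentumNormSq (2 * k + 1 + 1) m < η ^ 2 → (∀ w : Fock (Orb (FermionTorus 2 (2 * k + 1 + 1))), w ∈ szSector (Λ := FermionTorus 2 (2 * k + 1 + 1)) (2 * ⌊(1 - δ) * ((2 * k + 1 + 1 : ℕ)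 : ℝ) ^ 2 / 2⌋₊ - 2) 0 → 2 * (star w ⬝ᵥ (pairFieldAt dWaveFormFactor (2 * k + 1 + 1) m *ᵥ ψ)).re - ((star w ⬝ᵥ (hubbardTorus 2 (2 * k + 1 + 1) 1 U *ᵥ w)).re - (hubbardTorus 2 (2 * k + 1 + 1) 1 U).minEnergyOn (szSector (2 * ⌊(1 - δ) * ((2 * k + 1 + 1 : ℕ) : ℝ) ^ 2 / 2⌋₊ - 2) 0) * (star w ⬝ᵥ w).re) ≤ C * ((2 * k + 1 + 1 : ℕ) : ℝ) ^ 2 / momentumNormSq (2 * k + 1 + 1) m) ∧ (∀ w : Fock (Orb (FermionTorus 2 (2 * k + 1 + 1))), w ∈ szSector (Λ := FermionTorus 2 (2 * k + 1 + 1)) (2 * ⌊(1 - δ) * ((2 * k + 1 + 1 : ℕ) : ℝ) ^ 2 / 2⌋₊ + 2) 0 → 2 * (star w ⬝ᵥ ((pairFieldAt dWaveFormFactor (2 * k + 1 + 1) m)ᴴ *ᵥ ψ)).re - ((star w ⬝ᵥ (hubbardTorus 2 (2 * k + 1 + 1) 1 U *ᵥ w)).re - (hubbardTorus 2 (2 *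 k + 1 + 1) 1 U).minEnergyOn (szSector (2 * ⌊(1 - δ) * ((2 * k + 1 + 1 : ℕ) : ℝ) ^ 2 / 2⌋₊ + 2) 0) * (star w ⬝ᵥ w).re) ≤ C * ((2 * k + 1 + 1 : ℕ) : ℝ) ^ 2 / momentumNormSq (2 * k + 1 + 1) m)) → (∃ U₀ : ℝ, 0 < U₀ ∧ ∀ U ∈ Set.Ioo (0:ℝ) U₀, ∀ δ ∈ Set.Ioo (0:ℝ) (1 / 2), ∀ μ : ℝ, Filter.Tendsto (fun L : ℕ => ((hubbardTorusWith 2 (L + 1) 1 U μ).groundStateFunctional totalNumber).re / ((L + 1 : ℕ) : ℝ) ^ 2) Filter.atTop (nhds (1 - δ)) → HasDWaveOrder U μ → ∀ R : ℕ, 0 < R → ∃ C : ℝ, 0 ≤ C ∧ ∃ κ₀ : ℝ, 0 < κ₀ ∧ ∃ h₀ : ℝ, 0 < h₀ ∧ ∀ κ ∈ Set.Ioo (0:ℝ) κ₀, ∀ h ∈ Set.Ioo (0:ℝ) h₀, ∀ᶠ L : ℕ in Filter.atTop, -C * κ ^ 2 * ((L + 1 : ℕ) : ℝ) ^ 2 ≤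 (dWaveSourceTorus (L + 1) U μ h + (κ : ℂ) • (((((R : ℝ) ^ 4)⁻¹ : ℝ) : ℂ) • ∑ a : Literature.Probability.LatticeModels.TorusSite 2 (L + 1), (∑ u : Fin 2 → Fin R, localPair dWaveFormFactor (L + 1) (a + fun i => ((u i : ℕ) : ZMod (L + 1))))ᴴ * (∑ u : Fin 2 → Fin R, localPair dWaveFormFactor (L + 1) (a + fun i => ((u i : ℕ) : ZMod (L + 1)))))).groundEnergy + (dWaveSourceTorus (L + 1) U μ h + ((-κ : ℝ) : ℂ) • (((((R : ℝ) ^ 4)⁻¹ : ℝ) : ℂ) • ∑ a : Literature.Probability.LatticeModels.TorusSite 2 (L + 1), (∑ u : Fin 2 → Fin R, localPair dWaveFormFactor (L + 1) (a + fun i => ((u i : ℕ) : ZMod (L + 1))))ᴴ * (∑ u : Fin 2 → Fin R, localPair dWaveFormFactor (L + 1) (a + fun i => ((u i : ℕ) : ZMod (L + 1)))))).groundEnergy - 2 * (dWaveSourceTorus (L + 1) U μ h).groundEnergy) → (∃ U₀ : ℝ, 0 < U₀ ∧ ∀ U ∈ Set.Ioo (0:ℝ) U₀, ∀ δ ∈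 Set.Ioo (0:ℝ) (1 / 2), ∀ μ : ℝ, Filter.Tendsto (fun L : ℕ => ((hubbardTorusWith 2 (L + 1) 1 U μ).groundStateFunctional totalNumber).re / ((L + 1 : ℕ) : ℝ) ^ 2) Filter.atTop (nhds (1 - δ)) → HasDWaveOrder U μ → ∀ ε : ℝ, 0 < ε → ∀ᶠ k : ℕ in Filter.atTop, -ε ≤ (1 + Real.log ((2 * k + 1 + 1 : ℕ) : ℝ)) * pairGap (hubbardTorus 2 (2 * k + 1 + 1) 1 U) (2 * ⌊(1 - δ) * ((2 * k + 1 + 1 : ℕ) : ℝ) ^ 2 / 2⌋₊)) → Summit.HubbardSuperconductivity.HubbardSuperconductivity.Theses.ChiralWindow.CwSsbToEvenTorusLRO :=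
  fun hT hN hC =>
    (show Summit.HubbardSuperconductivity.HubbardSuperconductivity.Theses.ChiralWindow.CwSsbToEvenTorusLRO ↔ Summit.HubbardSuperconductivity.HubbardSuperconductivity.Theses.WeakCouplingBCS.WcbcsSsbToTorusLRO from Iff.rfl).mpr
      (wcbcsSsbToTorusLRO_of_stiffness_curvature_charging hT hN hC)

/-- **The crux from the neutral-curvature floor (N) and the pointwise weak-coupling leak S7 (CONDITIONAL glue) — the
sixth corner of the residue map.** The twin's registered `stub_neutralCurvature` (stmt-2009; h-uniform floor `−C_R κ² L²` on the
Kac-block second difference of the sourced torus energy = the certificate of Transfer A / no block kink) together with THIS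
crux's registered guarded leak `stub_infraredLeak` (S7 of line `griffiths-block-slope`; strictly weaker than item stmt-1089:
only `U < U₀`, only under density matching and `HasDWaveOrder`) imply `ChiralWindow.CwSsbToEvenTorusLRO` BY NAME, with
`U₀ :=` the smaller threshold: `derivFacePurity_of_neutralCurvature` (item stmt-9491 discharged by the landed
`stub_canonicalSupportingPotential`), the dissection `floor_of_deriv_of_leak` (Fejér closure) fed with S7 directly instead of
`leak_of_windowInfraredBound`, and `hasDWavePairFieldLROAt_of_floor`. With this theorem every pair
{S2' | N} × {stmt-1089 | S7 | T ∧ C} closes the crux by a landed theorem. [folklore] -/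
theorem cwSsbToEvenTorusLRO_of_neutralCurvature_of_infraredLeak :
    (∃ U₀ : ℝ, 0 < U₀ ∧ ∀ U ∈ Set.Ioo (0:ℝ) U₀, ∀ δ ∈ Set.Ioo (0:ℝ) (1 / 2), ∀ μ : ℝ, Filter.Tendsto (fun L : ℕ => ((hubbardTorusWith 2 (L + 1) 1 U μ).groundStateFunctional totalNumber).re / ((L + 1 : ℕ) : ℝ) ^ 2) Filter.atTop (nhds (1 - δ)) → HasDWaveOrder U μ → ∀ R : ℕ, 0 < R → ∃ C : ℝ, 0 ≤ C ∧ ∃ κ₀ : ℝ, 0 < κ₀ ∧ ∃ h₀ : ℝ, 0 < h₀ ∧ ∀ κ ∈ Set.Ioo (0:ℝ) κ₀, ∀ h ∈ Set.Ioo (0:ℝ) h₀, ∀ᶠ L : ℕ in Filter.atTop, -C * κ ^ 2 * ((L + 1 : ℕ) : ℝ) ^ 2 ≤ (dWaveSourceTorus (L + 1) U μ h + (κ : ℂ) • (((((R : ℝ) ^ 4)⁻¹ : ℝ) : ℂ) • ∑ a : Literature.Probability.LatticeModels.TorusSite 2 (L + 1), (∑ u : Fin 2 → Fin R, localPair dWaveFormFactor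 (L + 1) (a + fun i => ((u i : ℕ) : ZMod (L + 1))))ᴴ * (∑ u : Fin 2 → Fin R, localPair dWaveFormFactor (L + 1) (a + fun i => ((u i : ℕ) : ZMod (L + 1)))))).groundEnergy + (dWaveSourceTorus (L + 1) U μ h + ((-κ : ℝ) : ℂ) • (((((R : ℝ) ^ 4)⁻¹ : ℝ) : ℂ) • ∑ a : Literature.Probability.LatticeModels.TorusSite 2 (L + 1), (∑ u : Fin 2 → Fin R, localPair dWaveFormFactor (L + 1) (a + fun i => ((u i : ℕ) : ZMod (L + 1))))ᴴ * (∑ u : Fin 2 → Fin R, localPair dWaveFormFactor (L + 1) (a + fun i => ((u i : ℕ) : ZMod (L + 1)))))).groundEnergy - 2 * (dWaveSourceTorus (L + 1) U μ h).groundEnergy) → (∃ U₀ : ℝ, 0 < U₀ ∧ ∀ U ∈ Set.Ioo (0:ℝ) U₀, ∀ δ ∈ Set.Ioo (0:ℝ) (1 / 2), ∀ μ : ℝ, Filter.Tendsto (fun L : ℕ => ((hubbardTorusWith 2 (L + 1) 1 U μ).groundStateFunctional totalNumber).re / ((L + 1 : ℕ) : ℝ) ^ 2) Filter.atTop (nhds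 (1 - δ)) → HasDWaveOrder U μ → ∀ b : ℝ, 0 < b → ∃ η : ℝ, 0 < η ∧ ∀ᶠ k : ℕ in Filter.atTop, ∀ ψ : Fock (Orb (FermionTorus 2 (2 * k + 1 + 1))), IsGroundStateInSector (hubbardTorus 2 (2 * k + 1 + 1) 1 U) (2 * ⌊(1 - δ) * ((2 * k + 1 + 1 : ℕ) : ℝ) ^ 2 / 2⌋₊) 0 ψ → star ψ ⬝ᵥ ψ = 1 → (∑ m ∈ (Finset.univ.filter fun m : Literature.Probability.LatticeModels.TorusSite 2 (2 * k + 1 + 1) => m ≠ 0 ∧ momentumNormSq (2 * k + 1 + 1) m < η ^ 2), pairStructureFactor dWaveFormFactor (2 * k + 1 + 1) ψ m) / ((2 * k + 1 + 1 : ℕ) : ℝ) ^ 2 ≤ b) → Summit.HubbardSuperconductivity.HubbardSuperconductivity.Theses.ChiralWindow.CwSsbToEvenTorusLRO := by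
  intro hN hIR
  obtain ⟨U₁, hU₁, hN⟩ := hN
  obtain ⟨U₂, hU₂, hIR⟩ := hIR
  refine ⟨min U₁ U₂, lt_min hU₁ hU₂, fun U hU δ hδ μ hdm hord => ?_⟩
  have hU1 : U ∈ Set.Ioo (0:ℝ) U₁ := ⟨hU.1, lt_of_lt_of_le hU.2 (min_le_left _ _)⟩
  have hU2 : U ∈ Set.Ioo (0:ℝ) U₂ := ⟨hU.1, lt_of_lt_of_le hU.2 (min_le_right _ _)⟩
  have hP := derivFacePurity_of_neutralCurvature U δ μ hδ (hN U hU1 δ hδ μ hdm hord)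
    (stub_canonicalSupportingPotential U δ ⟨hδ.1, by linarith [hδ.2]⟩) hdm hord
  exact hasDWavePairFieldLROAt_of_floor (floor_of_deriv_of_leak hP (hIR U hU2 δ hδ μ hdm hord))

end Summit.HubbardSuperconductivity.HubbardSuperconductivity.Theorems.CwSsbToEvenTorusLRO

end
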